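import Literature.MathematicalPhysics.QuantumFieldTheory.Balaban1983to89.Node00.TorusCoverLocalGaugePrint
import Literature.MathematicalPhysics.QuantumFieldTheory.Balaban1983to89.Node00.TorusCoverGaugeTokensR10

/-!
# NODE 00 — THE TORUS→`ℤᵈ` TWIN AT PRINT'S CUBES, FILE P3: ★★★ THE K0 ROAD's (152)∕(9) TOKENS FROM [6] PROPOSITION 6 ON PRINT'S CUBE CLASS `zdCubP (M_N ℂ) L ρ`
# — `Gauge152OfClassTopStepR10 ∕ R F N suppDomOfRecord M ((11·4 + 4ρ)·L) (b9OfP F M ρ B₁) (a0OfP F N M ρ B₁ c₁)` for every cube letter `M` and every print big block `ρ ≥ L`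
# (repair (R-b) of record, item (b2): FILE 29's `gauge152R_of_prop6` ∕ 34c's `gauge152R10_of_prop6` re-derived at the print datum; additive, nothing landed edited)

Cell `pub-ymgap`, seat `pub-ymgap-dag-n07-e` generation 15 (R141 (C) s3 «torus-vs-box twin», DAG node N07 = [15]; INTENT-36, bus 2026-08-28).  NEW leaf; CONSUMED BY NAME,
nothing modified: FILE P1 `TorusCoverCubeMemberPrint` (`propCubeP`, `cubeIdxP'`, `sideP_le`, `cover_image_Ω_cubeIdxP'_subset`, `cover_image_Ω_cubeIdxP'_one_subset_hullD`,
`boxWidth_propCubeP`), FILE P2 `TorusCoverLocalGaugePrint` (`exists_localGauge10_cube_of_prop6P`), FILE 29 `TorusCoverGaugeTokensR` (`Gauge152OfClassTopStepR`,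
`Gauge9RegSepTopStepR`, `gauge9R_of_prop8TopStep_of_gauge152R`), 34c `TorusCoverGaugeTokensR10` (`Gauge152OfClassTopStepR10`, `.toR`, `Gauge9RegSepTopStepR10`,
`gauge9R10_of_prop8TopStep_of_gauge152R10`), k0-s2-w2's `CarriersB8CubePrint` (`zdCubP`, `prop6Printed_zdCubP_anti`), p532575∕20d-L (`Prop8RegSepTopStep`), def-R's
`suppDomOfRecord`.  `--kind definition --supports stmt-QuantumFields-20541` (K0⁷).
[15] = [Balaban1985Variational]; [6] = [Balaban1985RegularSpaces]; [III] = [Balaban1988Convergent].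

WHY (plan g79 WORDS-1 (B) ∕ WORD-B1-DECLARER, bus l.24699 ∕ l.24860).  K0⁷ stub 2 as typed (`B8.Prop6Printed 4 L B₁ c₁ (zdCub (M_2 ℂ) L ·)`) is [6] Prop. 6 at ALL
collars `ρ ≥ L` — wider than print (p. 98: `ρ = R₁M₁`, `M ∈ R₁M₁ℕ`, big-block corners; k0-s2-w2's located census).  The repair of record (R-b) re-states it on PRINT's class:
stub 2′ = `∀ F, ∃ ρ₀ B₁ c₁, 1 ≤ ρ₀ ∧ 0 ≤ B₁ ∧ 0 < c₁ ∧ B8.Prop6Printed 4 (F.L:ℝ) B₁ c₁ (fun i : ZdIdx 4 F.L => zdCubP (MatA 2) F.L ρ₀ i)` ((b1) = the member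
`zdCubP`, p587541).  The K0 consumer of stub 2 — FILE 29's `gauge152R_of_prop6` ∕ 34c's `gauge152R10_of_prop6` — read Proposition 6 at `propCube` (collar `L`), NOT a
print cube; THIS FILE ((b2)) re-derives the same TOKENS from Proposition 6 on print's class, at the print datum `propCubeP` of FILE P1 (collar `ρ` exactly, side a
multiple of `ρ`, corner on the `ρ`-grid).  What moves: the FLOOR LETTER of the tokens, `(11·4 + 3L)·L ↦ (11·4 + 4ρ)·L` (the print collar `2ρ`, corner shift `< ρ` and side
surplus `≤ 11d + 2ρ` inside print's separation layer `LⁿM₁` ∕ the support's layer `M₁`), and the constants: `b9OfP F M ρ B₁ = 112·L⁵·B₁·(LM + 44 + 2ρ) + 1`,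
`a0OfP F N M ρ B₁ c₁` = FILE 29's `a0Of` with `LM + 44 + L ↦ LM + 44 + 2ρ`.  For stub 2′'s BARE `ρ₀ ≥ 1` take the print big block `ρ := ρ₀·L ≥ L` (Proposition 6 on the
`ρ₀`-cubes gives it on the `ρ₀L`-cubes, `prop6Printed_zdCubP_anti`): floor `(44 + 4ρ₀L)·L` (§3).  The (9)-step compositions of FILE 29 ∕ 34c apply verbatim (§4).
The cube letter `M` stays FREE (n21-c (b3), bus 2026-08-28: `ρ₀` threads only through the floor and the two constants).

WHAT IS PROVED (kernel; `d = 4`; NO estimate of Bałaban — Proposition 6 on print's class is the displayed hypothesis `hP6`).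
§1 `b9OfP` · `a0OfP` (defs) · `b9OfP_pos` · `a0OfP_pos`.
§2 ★★★ `gauge152R10P_of_prop6` (`0 ≤ B₁`, `0 < c₁`, `F.L ≤ ρ`, `hP6` on `zdCubP (MatA N) F.L ρ` ⇒ `Gauge152OfClassTopStepR10 F N suppDom M ((11·4 + 4ρ)·L) (b9OfP …) (a0OfP …)`,
   every `M`) · ★★★ `gauge152RP_of_prop6` (the three-letter token, `.toR`).
§3 ★ `gauge152R10P_of_prop6_of_one_le` ∕ `gauge152RP_of_prop6_of_one_le` (bare `1 ≤ ρ₀`: `ρ := ρ₀·L`, floor `(11·4 + 4·(ρ₀·L))·L`).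
§4 ★ `gauge9R10P_of_prop8TopStep_of_prop6P` ∕ `gauge9RP_of_prop8TopStep_of_prop6P` ([15] Thm 1 (9)(–(10)) for critical configurations ⟸ Prop. 8's top step ∧ Prop. 6 on
   print's class; `0 < B₃`, `B₃a₁ ≤ a0OfP`) · `…_of_one_le` forms.
HONEST FRAMING: two constants + compositions BY NAME whose displayed input is [6] Proposition 6 ON PRINT'S CLASS at NODE 00's `ℤᵈ` member over n05-a's whole index (N05's node;
stub 2′'s body; n05-e ∕ k0-s2-w1's γ road and k0-s2-w1's (E) road aim at it — never asserted here) and, in §4, [15] Prop. 8's top step (V18 stub 1; never asserted here);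
nothing of Bałaban discharged; stub 2′ ∕ N05 ∕ N07 ∕ K0⁷ NOT discharged; V18 stands until the plan's V19; counts unmoved (5∕27); one finite T⁴ programme at fixed ε — NOT
continuum ∕ ℝ⁴ ∕ infinite volume ∕ OS ∕ mass gap ∕ Clay.  Two `def`s, no `instance`, no `notation`, no `sorry`.
-/

noncomputable section

namespace Literature.MathematicalPhysics.QuantumFieldTheory.Balaban1983to89.Node00

open scoped Matrix.Norms.L2Operator
open T4Continuum (T4Family)
open B15DeterminingSets B12RegularSpaces111
open B15Eq112TorusCover (cover)
open B14DomainGeom (Pt)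
open B14.Eq213MaximalDomains (side cubeExt)
open B7Prop1Explicit (e)
open B8Eq131Cubes (box tcube bLo bHi)
open B8LeafModelZd (ZdIdx)

/-! ## §1  The constants at print's collar -/

section Constants

variable (F : T4Family) (N : ℕ) [NeZero N]

/-- The constant `B₉(L, M, ρ, B₁) = 112·L⁵·B₁·(LM + 44 + 2ρ) + 1` of `gauge152R10P_of_prop6` (twice print's `7dL²B₁M′` at `α₀ = L³ε_{n−1} ≤ 2L³ε_n`, `M′ ≤ LM + 44 + 2ρ` at the
larger cube family, `+1` for the strict inequality) — FILE 29's `b9Of` with `L ↦ 2ρ` in the side surplus. [cite: Balaban1985Variational, (152) p.301 («9dL²B₁Mε₀»; bookkeeping)] -/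
def b9OfP (M ρ : ℕ) (B₁ : ℝ) : ℝ := 112 * (F.L : ℝ) ^ 5 * B₁ * ((F.L * M + 44 + 2 * ρ : ℕ) : ℝ) + 1

/-- The ceiling `a₀(L, N, M, ρ, B₁, c₁)` of `gauge152R10P_of_prop6` (print's «9dL²Mε₀ ≦ c₁» and the `2π`-window of the determinant normalisation, both at the larger family and
the print side `M′ ≤ LM + 44 + 2ρ`) — FILE 29's `a0Of` with `L ↦ 2ρ` in the side surplus. [cite: Balaban1985Variational, (152) p.301 («We assume that 9dL²Mε₀ ≦ c₁»; bookkeeping)] -/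
def a0OfP (M ρ : ℕ) (B₁ c₁ : ℝ) : ℝ :=
  min (c₁ / (56 * (F.L : ℝ) ^ 5 * ((F.L * M + 44 + 2 * ρ : ℕ) : ℝ)))
    (1 / (8 * ((F.L * M + 44 + 2 * ρ : ℕ) : ℝ) * N * (28 * (F.L : ℝ) ^ 5 * B₁ * ((F.L * M + 44 + 2 * ρ : ℕ) : ℝ)) + 1))

variable {F N}

omit [NeZero N] in
/-- `0 < a₀` when `0 < c₁` and `0 ≤ B₁` (the token at this ceiling is not vacuous). [cite: Balaban1985Variational, (152) p.301 (bookkeeping)] -/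
theorem a0OfP_pos (M ρ : ℕ) {B₁ c₁ : ℝ} (hB₁ : 0 ≤ B₁) (hc₁ : 0 < c₁) : 0 < a0OfP F N M ρ B₁ c₁ := by
  have hL : (0 : ℝ) < F.L := by exact_mod_cast (F.P 0).L_pos
  have hM' : (0 : ℝ) < ((F.L * M + 44 + 2 * ρ : ℕ) : ℝ) := by positivity
  unfold a0OfP
  exact lt_min (by positivity) (by positivity)

/-- `0 < B₉`. [cite: Balaban1985Variational, (152) p.301 (bookkeeping)] -/
theorem b9OfP_pos (M ρ : ℕ) {B₁ : ℝ} (hB₁ : 0 ≤ B₁) : 0 < b9OfP F M ρ B₁ := by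
  unfold b9OfP; positivity

end Constants

/-! ## §2  ★★★ The tokens from [6] Proposition 6 ON PRINT'S CLASS, at print big block `ρ ≥ L` -/

section Wrapper

variable {F : T4Family} {N : ℕ} [NeZero N]

/-- ★★★ **`Gauge152OfClassTopStepR10 … suppDomOfRecord M ((11·4 + 4ρ)·L) (b9OfP F M ρ B₁) (a0OfP F N M ρ B₁ c₁) ⟸ [6] PROP. 6 ON PRINT'S CUBE CLASS AT THE MEMBER`** (every cube
letter `M`, every print big block `ρ ≥ L`).  34c's `gauge152R10_of_prop6` re-derived at the PRINT datum: the empty cube at `M = 0`; the generic cube letter `M₀ ∈ {M, LM}` at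
scale `n`: the collar clause from `Sect2.SeqSeparated` (FILE P1 `cover_image_Ω_cubeIdxP'_subset`, floor `11d + 4ρ ≤ (11d + 4ρ)·L ≤ M₁`) ∕ the hull at `n = 1` (FILE P1
`cover_image_Ω_cubeIdxP'_one_subset_hullD`, floor `(11d + 4ρ)·L ≤ M₁`), print's «7dL²M′α₀ ≤ c₁» and the `2π`-window from `ε_{n−1} ≤ a0OfP` with `M′ = sideP ≤ M₀ + 44 + 2ρ ≤
LM + 44 + 2ρ`, FILE P2's four-letter push-down `exists_localGauge10_cube_of_prop6P` (at `ρ₀ := ρ`), the letters at `2r < b9OfP·ε_n` from `ε_{n−1} ≤ 2ε_n`.  Proposition 6 on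
print's class at the member is the HYPOTHESIS `hP6` (N05's node — stub 2′'s body at `ρ₀ := ρ`).
[cite: Balaban1985Variational, (144)–(152) pp.300–301, Thm 1 (9)–(10) p.279; Balaban1985RegularSpaces, Prop. 6 (1.135)–(1.136) p.99, p.98; Balaban1988Convergent, (2.13) p.256, p.255] -/
theorem gauge152R10P_of_prop6 {B₁ c₁ : ℝ} (hB₁ : 0 ≤ B₁) (hc₁ : 0 < c₁) {ρ : ℕ} (hρ : F.L ≤ ρ)
    (hP6 : letI : CStarAlgebra (MatA N) := {}; B8.Prop6Printed 4 (F.L : ℝ) B₁ c₁ (fun i : ZdIdx 4 F.L => zdCubP (MatA N) F.L ρ i)) (M : ℕ) :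
    Gauge152OfClassTopStepR10 F N (fun ν K Ω => suppDomOfRecord F ν K Ω) M ((11 * 4 + 4 * ρ) * F.L) (b9OfP F M ρ B₁) (a0OfP F N M ρ B₁ c₁) := by
  intro ν g K k s hsep hM₁ hfloor hk ε hε hcomp hcomp' U h17 h19 n hn1 hnk S hS hSN a _ hΩ
  have hL2 : 2 ≤ F.L := (F.P 0).hL.2
  have hL : (1 : ℝ) ≤ F.L := by exact_mod_cast (F.P 0).L_pos
  have hd : 2 ≤ (F.P K).d := by rw [T4Family.P_d]; norm_num
  have hNr : (1 : ℝ) ≤ N := by exact_mod_cast NeZero.pos N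
  have hρ' : (F.P K).L ≤ ρ := by rw [T4Family.P_L]; exact hρ
  set M₂ : ℕ := F.L * M + 44 + 2 * ρ with hM₂
  have ha₀ := a0OfP_pos (F := F) (N := N) M ρ hB₁ hc₁
  -- the case `M = 0`: the cube is empty
  rcases Nat.eq_zero_or_pos M with hM0 | hMpos
  · subst hM0
    have hS0 : S = 0 := by rcases hS with h | h <;> simp [h, side]
    subst hS0
    have hempty : ∀ y, y ∉ cubeEnl (F.P K) 0 a 0 := by
      rintro y ⟨z, hz, -⟩
      have h0 := hz ⟨0, by rw [T4Family.P_d]; norm_num⟩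
      simp only [Nat.cast_zero, zero_mul, sub_zero, add_zero] at h0
      omega
    exact ⟨fun _ => 1, fun _ => 0, fun b hb => (hempty _ hb.1).elim, fun b hb => (hempty _ hb.1).elim, fun q hq => (hempty _ hq.1).elim,
      fun b hb => (hempty _ hb.1).elim⟩
  -- the generic cube letter `M₀ ∈ {M, LM}` at scale `n`
  have key : ∀ M₀ : ℕ, 1 ≤ M₀ → M₀ + 44 + 2 * ρ ≤ M₂ → ((side (F.P K).L M₀ n : ℕ) : ℤ) < (F.P K).sitesPerDir 0 →
      cubeEnl (F.P K) (side (F.P K).L M₀ n) a 0 ⊆ s.Ω n →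
      Sect2.LocalGauge10On (cubeEnl (F.P K) (side (F.P K).L M₀ n) a 0) ((F.P K).eta n) (b9OfP F M ρ B₁ * ε n) U := by
    intro M₀ hM₀ hM₀' hSN₀ hΩ₀
    have hεn1 : 0 < ε (n - 1) := (hε (n - 1) (by omega)).1
    have hεn1a : ε (n - 1) ≤ a0OfP F N M ρ B₁ c₁ := (hε (n - 1) (by omega)).2
    have hεn : 0 < ε n := (hε n hnk).1
    have hε2 : ε (n - 1) ≤ 2 * ε n := by
      have := hcomp (n - 1) (by omega)
      rwa [show n - 1 + 1 = n by omega] at this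
    -- the print side `M′ = sideP ≤ M₀ + 44 + 2ρ ≤ M₂`
    have hside : sideP (F.P K) M₀ ρ ≤ M₂ := by
      have := sideP_le (P := F.P K) M₀ ρ
      rw [T4Family.P_d] at this
      omega
    have hM'r : ((sideP (F.P K) M₀ ρ : ℕ) : ℝ) ≤ (M₂ : ℝ) := by exact_mod_cast hside
    have hM'pos : (0 : ℝ) < ((sideP (F.P K) M₀ ρ : ℕ) : ℝ) := by
      have := le_sideP (P := F.P K) M₀ (lt_of_lt_of_le (F.P K).L_pos hρ')
      exact_mod_cast (show 0 < sideP (F.P K) M₀ ρ by omega)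
    have hM₂pos : (0 : ℝ) < M₂ := lt_of_lt_of_le hM'pos hM'r
    -- the collar clause
    have hcollar : cover (F.P K) '' (cubeIdxP' (F.P K) n hn1 M₀ ρ a).Ω 0 ⊆
        (if n - 1 = 0 then suppDomOfRecord F ν K s.Ω else s.Ω (n - 1)) := by
      rcases Nat.eq_or_lt_of_le hn1 with h1 | h1
      · subst h1
        rw [if_pos rfl, suppDomOfRecord_eq]
        exact cover_image_Ω_cubeIdxP'_one_subset_hullD hρ' (by rw [T4Family.P_d, T4Family.P_L]; exact hfloor) hM₀ a hΩ₀ 0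
      · rw [if_neg (by omega)]
        refine cover_image_Ω_cubeIdxP'_subset s hsep hρ' ?_ h1 hnk hM₀ a hΩ₀ 0
        rw [T4Family.P_d]
        exact le_trans (Nat.le_mul_of_pos_right _ (F.P 0).L_pos) hfloor
    -- the smallness «7dL²M′α₀ ≤ c₁»
    have ha₀c : a0OfP F N M ρ B₁ c₁ ≤ c₁ / (56 * (F.L : ℝ) ^ 5 * M₂) := by rw [hM₂]; exact min_le_left _ _
    have ha₀w : a0OfP F N M ρ B₁ c₁ ≤ 1 / (8 * (M₂ : ℝ) * N * (28 * (F.L : ℝ) ^ 5 * B₁ * M₂) + 1) := by rw [hM₂]; exact min_le_right _ _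
    have hc₁' : 7 * (F.P K).d * ((F.P K).L : ℝ) ^ 2 * (propCubeP (F.P K) n hn1 M₀ ρ hρ' a).M * (((F.P K).L : ℝ) ^ 3 * ε (n - 1)) ≤ c₁ := by
      rw [propCubeP_M, T4Family.P_d, T4Family.P_L]
      have h1 : 7 * (4 : ℕ) * (F.L : ℝ) ^ 2 * ((sideP (F.P K) M₀ ρ : ℕ) : ℝ) * ((F.L : ℝ) ^ 3 * ε (n - 1)) ≤ 28 * (F.L : ℝ) ^ 5 * M₂ * a0OfP F N M ρ B₁ c₁ := by
        have : 7 * (4 : ℕ) * (F.L : ℝ) ^ 2 * ((sideP (F.P K) M₀ ρ : ℕ) : ℝ) * ((F.L : ℝ) ^ 3 * ε (n - 1)) =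
            28 * (F.L : ℝ) ^ 5 * ((sideP (F.P K) M₀ ρ : ℕ) : ℝ) * ε (n - 1) := by push_cast; ring
        rw [this]; gcongr
      have h2 : 28 * (F.L : ℝ) ^ 5 * M₂ * a0OfP F N M ρ B₁ c₁ ≤ 28 * (F.L : ℝ) ^ 5 * M₂ * (c₁ / (56 * (F.L : ℝ) ^ 5 * M₂)) :=
        mul_le_mul_of_nonneg_left ha₀c (by positivity)
      have h3 : 28 * (F.L : ℝ) ^ 5 * M₂ * (c₁ / (56 * (F.L : ℝ) ^ 5 * M₂)) = c₁ / 2 := by field_simp; ring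
      linarith
    -- the `2π`-window of the normalisation
    have h2π : (2 * boxWidth (bLo (F.P K).L (propCubeP (F.P K) n hn1 M₀ ρ hρ' a).a (propCubeP (F.P K) n hn1 M₀ ρ hρ' a).k 0)
        (bHi (F.P K).L (propCubeP (F.P K) n hn1 M₀ ρ hρ' a).a (propCubeP (F.P K) n hn1 M₀ ρ hρ' a).M (propCubeP (F.P K) n hn1 M₀ ρ hρ' a).k 0) + 1) *
        ((F.P K).eta n * N * (7 * (F.P K).d * ((F.P K).L : ℝ) ^ 2 * B₁ * (propCubeP (F.P K) n hn1 M₀ ρ hρ' a).M * (((F.P K).L : ℝ) ^ 3 * ε (n - 1)) *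
          (((F.P K).L : ℝ) ^ (propCubeP (F.P K) n hn1 M₀ ρ hρ' a).k * (F.P K).eta n)⁻¹)) < 2 * Real.pi := by
      rw [boxWidth_propCubeP, propCubeP_M, propCubeP_k, B12Eq115BackgroundPair.pow_mul_eta, inv_one, mul_one, T4Family.P_d, T4Family.P_L]
      have hη : (F.L : ℝ) ^ n * (F.P K).eta n = 1 := by have := B12Eq115BackgroundPair.pow_mul_eta (F.P K) n; rwa [T4Family.P_L] at this
      have hηpos : 0 < (F.P K).eta n := B3GkZeroTorusRescaled.eta_pos (F.P K) n
      have hW : (2 * ((4 : ℕ) * ((F.L : ℝ) ^ n * ((sideP (F.P K) M₀ ρ : ℕ) : ℝ) - 1)) + 1) * (F.P K).eta n ≤ 8 * ((sideP (F.P K) M₀ ρ : ℕ) : ℝ) := by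
        have : (2 * ((4 : ℕ) * ((F.L : ℝ) ^ n * ((sideP (F.P K) M₀ ρ : ℕ) : ℝ) - 1)) + 1) * (F.P K).eta n =
            8 * ((sideP (F.P K) M₀ ρ : ℕ) : ℝ) * ((F.L : ℝ) ^ n * (F.P K).eta n) - 7 * (F.P K).eta n := by push_cast; ring
        rw [this, hη, mul_one]; linarith
      have hr : 7 * (4 : ℕ) * (F.L : ℝ) ^ 2 * B₁ * ((sideP (F.P K) M₀ ρ : ℕ) : ℝ) * ((F.L : ℝ) ^ 3 * ε (n - 1)) ≤ 28 * (F.L : ℝ) ^ 5 * B₁ * M₂ * a0OfP F N M ρ B₁ c₁ := by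
        have : 7 * (4 : ℕ) * (F.L : ℝ) ^ 2 * B₁ * ((sideP (F.P K) M₀ ρ : ℕ) : ℝ) * ((F.L : ℝ) ^ 3 * ε (n - 1)) =
            28 * (F.L : ℝ) ^ 5 * B₁ * ((sideP (F.P K) M₀ ρ : ℕ) : ℝ) * ε (n - 1) := by push_cast; ring
        rw [this]; gcongr
      set X : ℝ := 8 * (M₂ : ℝ) * N * (28 * (F.L : ℝ) ^ 5 * B₁ * M₂) with hX
      have hX0 : 0 ≤ X := by positivity
      have hXa : X * a0OfP F N M ρ B₁ c₁ < 1 := by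
        calc X * a0OfP F N M ρ B₁ c₁ ≤ X * (1 / (X + 1)) := mul_le_mul_of_nonneg_left ha₀w hX0
          _ < 1 := by rw [mul_one_div, div_lt_one (by positivity)]; linarith
      calc (2 * ((4 : ℕ) * ((F.L : ℝ) ^ n * ((sideP (F.P K) M₀ ρ : ℕ) : ℝ) - 1)) + 1) *
            ((F.P K).eta n * N * (7 * (4 : ℕ) * (F.L : ℝ) ^ 2 * B₁ * ((sideP (F.P K) M₀ ρ : ℕ) : ℝ) * ((F.L : ℝ) ^ 3 * ε (n - 1))))
          = ((2 * ((4 : ℕ) * ((F.L : ℝ) ^ n * ((sideP (F.P K) M₀ ρ : ℕ) : ℝ) - 1)) + 1) * (F.P K).eta n) *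
            (N * (7 * (4 : ℕ) * (F.L : ℝ) ^ 2 * B₁ * ((sideP (F.P K) M₀ ρ : ℕ) : ℝ) * ((F.L : ℝ) ^ 3 * ε (n - 1)))) := by ring
        _ ≤ (8 * ((sideP (F.P K) M₀ ρ : ℕ) : ℝ)) * (N * (28 * (F.L : ℝ) ^ 5 * B₁ * M₂ * a0OfP F N M ρ B₁ c₁)) := by
            gcongr
        _ ≤ (8 * (M₂ : ℝ)) * (N * (28 * (F.L : ℝ) ^ 5 * B₁ * M₂ * a0OfP F N M ρ B₁ c₁)) := by gcongr
        _ = X * a0OfP F N M ρ B₁ c₁ := by rw [hX]; ring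
        _ < 1 := hXa
        _ < 2 * Real.pi := by linarith [Real.pi_gt_three]
    obtain ⟨u, A, h1, h2, h3, h4⟩ :=
      exists_localGauge10_cube_of_prop6P (P := F.P K) hd hB₁ (dvd_refl ρ) hρ' hP6 U h17 h19 hn1 (by omega) hεn1 a hSN₀ hcollar hc₁' h2π
    -- the letters at `B₉·ε_n`
    have hbound : 2 * (7 * (F.P K).d * ((F.P K).L : ℝ) ^ 2 * B₁ * (propCubeP (F.P K) n hn1 M₀ ρ hρ' a).M * (((F.P K).L : ℝ) ^ 3 * ε (n - 1))) <
        b9OfP F M ρ B₁ * ε n := by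
      rw [propCubeP_M, T4Family.P_d, T4Family.P_L, b9OfP]
      have : 2 * (7 * (4 : ℕ) * (F.L : ℝ) ^ 2 * B₁ * ((sideP (F.P K) M₀ ρ : ℕ) : ℝ) * ((F.L : ℝ) ^ 3 * ε (n - 1))) =
          56 * (F.L : ℝ) ^ 5 * B₁ * ((sideP (F.P K) M₀ ρ : ℕ) : ℝ) * ε (n - 1) := by push_cast; ring
      rw [this]
      calc 56 * (F.L : ℝ) ^ 5 * B₁ * ((sideP (F.P K) M₀ ρ : ℕ) : ℝ) * ε (n - 1) ≤ 56 * (F.L : ℝ) ^ 5 * B₁ * M₂ * (2 * ε n) := by gcongr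
        _ = (112 * (F.L : ℝ) ^ 5 * B₁ * M₂) * ε n := by ring
        _ < (112 * (F.L : ℝ) ^ 5 * B₁ * ((F.L * M + 44 + 2 * ρ : ℕ) : ℝ) + 1) * ε n := by
            rw [hM₂]; exact mul_lt_mul_of_pos_right (lt_add_one _) hεn
    exact ⟨u, A, h1, fun b hb => (h2 b hb).trans_lt hbound, fun q hq => (h3 q hq).trans_lt hbound, fun b hb => (h4 b hb).trans_lt hbound⟩
  -- the two families
  rcases hS with rfl | rfl
  · exact key M hMpos (by rw [hM₂]; nlinarith [(F.P 0).L_pos]) hSN hΩ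
  · have hside : side (F.P K).L M (n + 1) = side (F.P K).L ((F.P K).L * M) n := by simp only [side, pow_succ]; ring
    rw [hside] at hSN hΩ ⊢
    exact key ((F.P K).L * M) (Nat.one_le_iff_ne_zero.2 (Nat.mul_ne_zero (F.P K).L_pos.ne' hMpos.ne')) (by rw [hM₂, T4Family.P_L]) hSN hΩ

/-- ★★★ **THE THREE-LETTER TOKEN OF THE K0 ROAD FROM [6] PROP. 6 ON PRINT'S CLASS** — FILE 29's `gauge152R_of_prop6` at print cubes: `Gauge152OfClassTopStepR F N suppDom M
((11·4 + 4ρ)·L) (b9OfP F M ρ B₁) (a0OfP F N M ρ B₁ c₁)` (34c's `.toR` of §2's token). [cite: Balaban1985Variational, (144)–(152) pp.300–301, Thm 1 (9) p.279; Balaban1985RegularSpaces, Prop. 6 p.99, p.98; Balaban1988Convergent, (2.13) p.256] -/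
theorem gauge152RP_of_prop6 {B₁ c₁ : ℝ} (hB₁ : 0 ≤ B₁) (hc₁ : 0 < c₁) {ρ : ℕ} (hρ : F.L ≤ ρ)
    (hP6 : letI : CStarAlgebra (MatA N) := {}; B8.Prop6Printed 4 (F.L : ℝ) B₁ c₁ (fun i : ZdIdx 4 F.L => zdCubP (MatA N) F.L ρ i)) (M : ℕ) :
    Gauge152OfClassTopStepR F N (fun ν K Ω => suppDomOfRecord F ν K Ω) M ((11 * 4 + 4 * ρ) * F.L) (b9OfP F M ρ B₁) (a0OfP F N M ρ B₁ c₁) :=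
  (gauge152R10P_of_prop6 hB₁ hc₁ hρ hP6 M).toR

end Wrapper

/-! ## §3  ★ Stub 2′'s bare `ρ₀ ≥ 1`: the print big block `ρ := ρ₀·L` -/

section BareBlock

variable {F : T4Family} {N : ℕ} [NeZero N]

/-- ★ **THE FOUR-LETTER TOKEN FROM PROP. 6 ON THE `ρ₀`-CUBES, ANY `ρ₀ ≥ 1`** (stub 2′'s shape): pass to the multiple `ρ := ρ₀·L ≥ L` (`prop6Printed_zdCubP_anti`) and apply §2 —
floor `(11·4 + 4·(ρ₀L))·L`, constants `b9OfP F M (ρ₀L) B₁`, `a0OfP F N M (ρ₀L) B₁ c₁`. [cite: Balaban1985Variational, (144)–(152) pp.300–301; Balaban1985RegularSpaces, Prop. 6 p.99, p.98 («M is a multiple of R₁M₁»)] -/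
theorem gauge152R10P_of_prop6_of_one_le {B₁ c₁ : ℝ} (hB₁ : 0 ≤ B₁) (hc₁ : 0 < c₁) {ρ₀ : ℕ} (hρ₀ : 1 ≤ ρ₀)
    (hP6 : letI : CStarAlgebra (MatA N) := {}; B8.Prop6Printed 4 (F.L : ℝ) B₁ c₁ (fun i : ZdIdx 4 F.L => zdCubP (MatA N) F.L ρ₀ i)) (M : ℕ) :
    Gauge152OfClassTopStepR10 F N (fun ν K Ω => suppDomOfRecord F ν K Ω) M ((11 * 4 + 4 * (ρ₀ * F.L)) * F.L) (b9OfP F M (ρ₀ * F.L) B₁)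
      (a0OfP F N M (ρ₀ * F.L) B₁ c₁) := by
  letI : CStarAlgebra (MatA N) := {}
  exact gauge152R10P_of_prop6 hB₁ hc₁ (Nat.le_mul_of_pos_left F.L hρ₀)
    (prop6Printed_zdCubP_anti (fun i : ZdIdx 4 F.L => i) (Dvd.intro F.L rfl) hP6) M

/-- ★ **THE THREE-LETTER TOKEN FROM PROP. 6 ON THE `ρ₀`-CUBES, ANY `ρ₀ ≥ 1`**. [cite: Balaban1985Variational, (144)–(152) pp.300–301; Balaban1985RegularSpaces, Prop. 6 p.99, p.98] -/
theorem gauge152RP_of_prop6_of_one_le {B₁ c₁ : ℝ} (hB₁ : 0 ≤ B₁) (hc₁ : 0 < c₁) {ρ₀ : ℕ} (hρ₀ : 1 ≤ ρ₀)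
    (hP6 : letI : CStarAlgebra (MatA N) := {}; B8.Prop6Printed 4 (F.L : ℝ) B₁ c₁ (fun i : ZdIdx 4 F.L => zdCubP (MatA N) F.L ρ₀ i)) (M : ℕ) :
    Gauge152OfClassTopStepR F N (fun ν K Ω => suppDomOfRecord F ν K Ω) M ((11 * 4 + 4 * (ρ₀ * F.L)) * F.L) (b9OfP F M (ρ₀ * F.L) B₁)
      (a0OfP F N M (ρ₀ * F.L) B₁ c₁) :=
  (gauge152R10P_of_prop6_of_one_le hB₁ hc₁ hρ₀ hP6 M).toR

end BareBlock

/-! ## §4  ★ The (9)-step compositions: [15] Thm 1 (9)(–(10)) for critical configurations ⟸ Prop. 8's top step ∧ Prop. 6 on print's class -/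

section NineStep

variable {F : T4Family} {N : ℕ} [NeZero N]

/-- ★ **[15] THM 1 (9)–(10) FOR CRITICAL CONFIGURATIONS ⟸ [15] PROP. 8's TOP STEP ∧ [6] PROP. 6 ON PRINT'S CLASS** (34c's `gauge9R10_of_prop8TopStep_of_gauge152R10` at §2's token):
`Gauge9RegSepTopStepR10 F N suppDom M ((11·4 + 4ρ)·L) B₃ (b9OfP·B₃) a₀ a₁` once `0 < B₃` and `B₃a₁ ≤ a0OfP F N M ρ B₁ c₁`.
[cite: Balaban1985Variational, Thm 1 (8)–(10) p.279, Prop. 8 p.304, (152) p.301; Balaban1985RegularSpaces, Prop. 6 p.99] -/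
theorem gauge9R10P_of_prop8TopStep_of_prop6P {B₃ a₀ a₁ B₁ c₁ : ℝ}
    (h8 : Prop8RegSepTopStep F N (fun ν K Ω => suppDomOfRecord F ν K Ω) B₃ a₀ a₁) (hB₁ : 0 ≤ B₁) (hc₁ : 0 < c₁) {ρ : ℕ} (hρ : F.L ≤ ρ)
    (hP6 : letI : CStarAlgebra (MatA N) := {}; B8.Prop6Printed 4 (F.L : ℝ) B₁ c₁ (fun i : ZdIdx 4 F.L => zdCubP (MatA N) F.L ρ i)) (M : ℕ)
    (hB₃ : 0 < B₃) (ha : B₃ * a₁ ≤ a0OfP F N M ρ B₁ c₁) :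
    Gauge9RegSepTopStepR10 F N (fun ν K Ω => suppDomOfRecord F ν K Ω) M ((11 * 4 + 4 * ρ) * F.L) B₃ (b9OfP F M ρ B₁ * B₃) a₀ a₁ :=
  gauge9R10_of_prop8TopStep_of_gauge152R10 h8 (gauge152R10P_of_prop6 hB₁ hc₁ hρ hP6 M) hB₃ ha

/-- ★ **[15] THM 1 (9) LINE 1 FOR CRITICAL CONFIGURATIONS ⟸ [15] PROP. 8's TOP STEP ∧ [6] PROP. 6 ON PRINT'S CLASS** (FILE 29's `gauge9R_of_prop8TopStep_of_gauge152R` at §2's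
token). [cite: Balaban1985Variational, Thm 1 (8)–(9) p.279, Prop. 8 p.304, (152) p.301; Balaban1985RegularSpaces, Prop. 6 p.99] -/
theorem gauge9RP_of_prop8TopStep_of_prop6P {B₃ a₀ a₁ B₁ c₁ : ℝ}
    (h8 : Prop8RegSepTopStep F N (fun ν K Ω => suppDomOfRecord F ν K Ω) B₃ a₀ a₁) (hB₁ : 0 ≤ B₁) (hc₁ : 0 < c₁) {ρ : ℕ} (hρ : F.L ≤ ρ)
    (hP6 : letI : CStarAlgebra (MatA N) := {}; B8.Prop6Printed 4 (F.L : ℝ) B₁ c₁ (fun i : ZdIdx 4 F.L => zdCubP (MatA N) F.L ρ i)) (M : ℕ)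
    (hB₃ : 0 < B₃) (ha : B₃ * a₁ ≤ a0OfP F N M ρ B₁ c₁) :
    Gauge9RegSepTopStepR F N (fun ν K Ω => suppDomOfRecord F ν K Ω) M ((11 * 4 + 4 * ρ) * F.L) B₃ (b9OfP F M ρ B₁ * B₃) a₀ a₁ :=
  gauge9R_of_prop8TopStep_of_gauge152R h8 (gauge152RP_of_prop6 hB₁ hc₁ hρ hP6 M) hB₃ ha

/-- The (9)–(10) composition at stub 2′'s bare `ρ₀ ≥ 1` (`ρ := ρ₀·L`). [cite: Balaban1985Variational, Thm 1 (8)–(10) p.279; Balaban1985RegularSpaces, Prop. 6 p.99, p.98] -/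
theorem gauge9R10P_of_prop8TopStep_of_prop6P_of_one_le {B₃ a₀ a₁ B₁ c₁ : ℝ}
    (h8 : Prop8RegSepTopStep F N (fun ν K Ω => suppDomOfRecord F ν K Ω) B₃ a₀ a₁) (hB₁ : 0 ≤ B₁) (hc₁ : 0 < c₁) {ρ₀ : ℕ} (hρ₀ : 1 ≤ ρ₀)
    (hP6 : letI : CStarAlgebra (MatA N) := {}; B8.Prop6Printed 4 (F.L : ℝ) B₁ c₁ (fun i : ZdIdx 4 F.L => zdCubP (MatA N) F.L ρ₀ i)) (M : ℕ)
    (hB₃ : 0 < B₃) (ha : B₃ * a₁ ≤ a0OfP F N M (ρ₀ * F.L) B₁ c₁) :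
    Gauge9RegSepTopStepR10 F N (fun ν K Ω => suppDomOfRecord F ν K Ω) M ((11 * 4 + 4 * (ρ₀ * F.L)) * F.L) B₃ (b9OfP F M (ρ₀ * F.L) B₁ * B₃) a₀ a₁ :=
  gauge9R10_of_prop8TopStep_of_gauge152R10 h8 (gauge152R10P_of_prop6_of_one_le hB₁ hc₁ hρ₀ hP6 M) hB₃ ha

/-- The (9) composition at stub 2′'s bare `ρ₀ ≥ 1` (`ρ := ρ₀·L`). [cite: Balaban1985Variational, Thm 1 (8)–(9) p.279; Balaban1985RegularSpaces, Prop. 6 p.99, p.98] -/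
theorem gauge9RP_of_prop8TopStep_of_prop6P_of_one_le {B₃ a₀ a₁ B₁ c₁ : ℝ}
    (h8 : Prop8RegSepTopStep F N (fun ν K Ω => suppDomOfRecord F ν K Ω) B₃ a₀ a₁) (hB₁ : 0 ≤ B₁) (hc₁ : 0 < c₁) {ρ₀ : ℕ} (hρ₀ : 1 ≤ ρ₀)
    (hP6 : letI : CStarAlgebra (MatA N) := {}; B8.Prop6Printed 4 (F.L : ℝ) B₁ c₁ (fun i : ZdIdx 4 F.L => zdCubP (MatA N) F.L ρ₀ i)) (M : ℕ)
    (hB₃ : 0 < B₃) (ha : B₃ * a₁ ≤ a0OfP F N M (ρ₀ * F.L) B₁ c₁) :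
    Gauge9RegSepTopStepR F N (fun ν K Ω => suppDomOfRecord F ν K Ω) M ((11 * 4 + 4 * (ρ₀ * F.L)) * F.L) B₃ (b9OfP F M (ρ₀ * F.L) B₁ * B₃) a₀ a₁ :=
  gauge9R_of_prop8TopStep_of_gauge152R h8 (gauge152RP_of_prop6_of_one_le hB₁ hc₁ hρ₀ hP6 M) hB₃ ha

end NineStep

end Literature.MathematicalPhysics.QuantumFieldTheory.Balaban1983to89.Node00

end
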